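import Summits.Ventures.PackingBounds.Configurations.OrthogonalSumConfig
import Summits.Ventures.PackingBounds.Configurations.PetersenCode
import Summits.Ventures.PackingBounds.Configurations.SimplexCrossPolytopeConfigs
import Summits.Ventures.PackingBounds.Conjectures.DiploSimplexThreshold

/-!
# The competitor family `X_n = Petersen code ⊕ β_{n-4}` of the diplo-simplex, every `n ≥ 5` (kernel energies)

Framing: lottery ticket; floor = certified bounds/negative ranges. Venture `PackingBounds` (cell `pub-packcert`, seat
`pub-packcert-energy`, gen 26) — structure file for Conjecture B of `Conjectures/DiploSimplexRiesz.lean` (cell STRUCTURE §2 entry C-B′).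

`X_{4+k} ⊂ S^{3+k}`: the ten points of the Petersen code (`Config.PetersenCode.exists_config`, in `ℝ⁴`) `⊕` the regular cross-polytope `β_k ⊂ ℝᵏ`
(`Config.SimplexCrossPolytope.crossPolytope k`), orthogonal sum transported to `ℝ^{4+k}` (`Config.OrthogonalSum.exists_transfer_osum`):
`2(4+k) + 2` unit vectors — the same size as the diplo-simplex `D_{4+k}` — with
`E_a(X_{4+k}) = 2k a(-1) + (36k + 4k²) a(0) + 60 a(1/6) + 30 a(-2/3)` for every potential `a` (`exists_petersenCross`;
`= 60a(1/6) + 30a(-2/3) + 2(n-4)a(-1) + [40(n-4) + 4(n-4)(n-5)]a(0)` with `n = 4 + k`; `k = 1` is the Petersen-plus-poles `X_5` of `Conjectures/DiploSimplexFive`). Float crossovers `E_s(X_n) = E_s(D_n)`: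
`s_c(5) = 2` (exact), `4.0866`, `6.0565`, `8.2182`, `11.605` for `n = 6, 7, 8, 9`, none for `n ≥ 10`. Kernel consequences here (rational
exponents): `¬ DiploMinimises 7 8` (`E_8(X_7) = 17.0424… < 17.1341… = dipValue 7 8`) and `¬ DiploMinimises 8 10`, `¬ DiploMinimises 9 12`,
`¬ DiploMinimises 9 14` — upper bounds `s*(7) < 8`, `s*(8) < 10`, `s*(9) < 12` for the Conjecture-B thresholds (cf. `DiploSimplexFive` / `…Six`:
`s*(5) ≤ 2` with a tie, `s*(6) < 6`).

## References
* B. Ballinger et al., Experiment. Math. 18 (2009) 257–283, §3.4. [`BallingerEtAl2009`]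
-/

noncomputable section

open Finset Module
open scoped RealInnerProductSpace

namespace Summit.Ventures.PackingBounds.Conjectures

open Summit.Ventures.PackingBounds.Config

/-- **The competitor `X_{4+k}`** (every `k`): `10 + 2k` unit vectors of `ℝ^{4+k}` with
`Σ_{x ≠ y} a(⟪x,y⟫) = 2k a(-1) + (36k + 4k²) a(0) + 60 a(1/6) + 30 a(-2/3)` for every potential `a`. -/
theorem exists_petersenCross (k : ℕ) : ∃ C : Finset (EuclideanSpace ℝ (Fin (4 + k))), C.card = 10 + 2 * k ∧
    (∀ z ∈ C, ‖z‖ = 1) ∧ ∀ a : ℝ → ℝ, ∑ x ∈ C, ∑ y ∈ C.erase x, a (inner ℝ x y) =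
      (2 * k : ℝ) * a (-1) + (36 * k + 4 * (k : ℝ) ^ 2) * a 0 + 60 * a (1 / 6) + 30 * a (-2 / 3) := by
  classical
  obtain ⟨P, hPc, hP1, -, hPE⟩ := PetersenCode.exists_config
  have hdim : finrank ℝ (EuclideanSpace ℝ (Fin 4)) + finrank ℝ (EuclideanSpace ℝ (Fin k)) = 4 + k := by
    rw [finrank_euclideanSpace_fin, finrank_euclideanSpace_fin]
  obtain ⟨C, hc, h1, hE⟩ := OrthogonalSum.exists_transfer_osum hdim P (SimplexCrossPolytope.crossPolytope k) hP1
    (SimplexCrossPolytope.norm_crossPolytope k)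
  refine ⟨C, by rw [hc, hPc, SimplexCrossPolytope.card_crossPolytope], h1, fun a => ?_⟩
  refine (hE a).trans ?_
  have e3 : (∑ x ∈ P, ∑ x' ∈ P.erase x, a (inner ℝ x x')) +
      (∑ y ∈ SimplexCrossPolytope.crossPolytope k, ∑ y' ∈ (SimplexCrossPolytope.crossPolytope k).erase y, a (inner ℝ y y')) +
      2 * (P.card : ℝ) * (SimplexCrossPolytope.crossPolytope k).card * a 0 =
      ((10 : ℝ) * (3 * a (-2 / 3) + 6 * a (1 / 6))) + ((2 * k : ℝ) * (a (-1) + (2 * k - 2) * a 0)) + 2 * (10 : ℝ) * (2 * k : ℕ) * a 0 := by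
    rw [hPE a, SimplexCrossPolytope.crossPolytope_energy, hPc, SimplexCrossPolytope.card_crossPolytope]
    push_cast
    ring
  convert e3.trans ?_ using 2
  push_cast
  ring

/-- For unit vectors and `s = 2m`: `‖x - y‖^{-s} = ((2 - 2⟪x,y⟫)^m)⁻¹`. [folklore] -/
private theorem norm_sub_rpow_neg_of_eq {N : ℕ} {x y : EuclideanSpace ℝ (Fin N)} (hx : ‖x‖ = 1) (hy : ‖y‖ = 1)
    (m : ℕ) (s : ℝ) (hs : s = 2 * (m : ℝ)) : ‖x - y‖ ^ (-s) = ((2 - 2 * inner ℝ x y) ^ m)⁻¹ := by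
  have hsq : ‖x - y‖ ^ 2 = 2 - 2 * inner ℝ x y := by rw [norm_sub_sq_real, hx, hy]; ring
  rw [hs, Real.rpow_neg (norm_nonneg _), show (2 * (m : ℝ)) = ((2 * m : ℕ) : ℝ) by push_cast; ring, Real.rpow_natCast,
    pow_mul, hsq]

/-- Riesz-`s` energy of `X_{4+k}` for `s = 2m`, closed form. -/
theorem exists_petersenCross_riesz (k m : ℕ) (s : ℝ) (hs : s = 2 * (m : ℝ)) :
    ∃ C : Finset (EuclideanSpace ℝ (Fin (4 + k))), C.card = 2 * (4 + k) + 2 ∧ (∀ z ∈ C, ‖z‖ = 1) ∧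
      ∑ x ∈ C, ∑ y ∈ C.erase x, ‖x - y‖ ^ (-s) =
        (2 * k : ℝ) * ((4 : ℝ) ^ m)⁻¹ + (36 * k + 4 * (k : ℝ) ^ 2) * ((2 : ℝ) ^ m)⁻¹ +
          60 * (((5 : ℝ) / 3) ^ m)⁻¹ + 30 * (((10 : ℝ) / 3) ^ m)⁻¹ := by
  obtain ⟨C, hc, h1, hE⟩ := exists_petersenCross k
  refine ⟨C, by rw [hc]; ring, h1, ?_⟩
  have hconv : ∑ x ∈ C, ∑ y ∈ C.erase x, ‖x - y‖ ^ (-s) =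
      ∑ x ∈ C, ∑ y ∈ C.erase x, (fun t => ((2 - 2 * t) ^ m)⁻¹) (inner ℝ x y) := by
    refine sum_congr rfl fun x hx => sum_congr rfl fun y hy => ?_
    exact norm_sub_rpow_neg_of_eq (h1 x hx) (h1 y (mem_of_mem_erase hy)) m s hs
  rw [hconv]
  refine (hE (fun t => ((2 - 2 * t) ^ m)⁻¹)).trans ?_
  norm_num

/-- **`¬ DiploMinimises 7 8`** (`X_7` beats `D_7` for Riesz `s = 8`: `17.0424… < 17.1341…`); so `s*(7) < 8`. [cite: BallingerEtAl2009, §3.4] -/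
theorem not_diploMinimises_seven_eight : ¬ DiploMinimises 7 8 := by
  intro h
  obtain ⟨C, hc, h1, hE⟩ := exists_petersenCross_riesz 3 4 8 (by norm_num)
  have hge := h C hc h1
  rw [hE, dipValue_of_eq 7 (by norm_num) 4 8 (by norm_num)] at hge
  norm_num at hge

/-- **`¬ DiploMinimises 8 10`** (`X_8` beats `D_8` for Riesz `s = 10`); so `s*(8) < 10`. [cite: BallingerEtAl2009, §3.4] -/
theorem not_diploMinimises_eight_ten : ¬ DiploMinimises 8 10 := by
  intro h
  obtain ⟨C, hc, h1, hE⟩ := exists_petersenCross_riesz 4 5 10 (by norm_num)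
  have hge := h C hc h1
  rw [hE, dipValue_of_eq 8 (by norm_num) 5 10 (by norm_num)] at hge
  norm_num at hge

/-- **`¬ DiploMinimises 9 12`** (`X_9` beats `D_9` for Riesz `s = 12`); so `s*(9) < 12`. [cite: BallingerEtAl2009, §3.4] -/
theorem not_diploMinimises_nine_twelve : ¬ DiploMinimises 9 12 := by
  intro h
  obtain ⟨C, hc, h1, hE⟩ := exists_petersenCross_riesz 5 6 12 (by norm_num)
  have hge := h C hc h1
  rw [hE, dipValue_of_eq 9 (by norm_num) 6 12 (by norm_num)] at hge
  norm_num at hge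

/-- **`¬ DiploMinimises 9 14`** (`X_9` beats `D_9` for Riesz `s = 14` as well: the `X_9` window is `11.6 < s < 17.5`). [cite: BallingerEtAl2009, §3.4] -/
theorem not_diploMinimises_nine_fourteen : ¬ DiploMinimises 9 14 := by
  intro h
  obtain ⟨C, hc, h1, hE⟩ := exists_petersenCross_riesz 5 7 14 (by norm_num)
  have hge := h C hc h1
  rw [hE, dipValue_of_eq 9 (by norm_num) 7 14 (by norm_num)] at hge
  norm_num at hge

/-- **At sample even exponents below the crossover the diplo-simplex beats `X_n`**: `dipValue 7 6 < E_6(X_7)` and `dipValue 8 8 < E_8(X_8)`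
(so `X_7`, `X_8` do not decide `s*(7)`, `s*(8)` below `6.06`, `8.22`). -/
theorem dipValue_lt_petersenCross_samples :
    (∃ C : Finset (EuclideanSpace ℝ (Fin (4 + 3))), C.card = 2 * (4 + 3) + 2 ∧ (∀ z ∈ C, ‖z‖ = 1) ∧
        dipValue 7 6 < ∑ x ∈ C, ∑ y ∈ C.erase x, ‖x - y‖ ^ (-(6 : ℝ))) ∧
      (∃ C : Finset (EuclideanSpace ℝ (Fin (4 + 4))), C.card = 2 * (4 + 4) + 2 ∧ (∀ z ∈ C, ‖z‖ = 1) ∧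
        dipValue 8 8 < ∑ x ∈ C, ∑ y ∈ C.erase x, ‖x - y‖ ^ (-(8 : ℝ))) := by
  constructor
  · obtain ⟨C, hc, h1, hE⟩ := exists_petersenCross_riesz 3 3 6 (by norm_num)
    refine ⟨C, hc, h1, ?_⟩
    rw [hE, dipValue_of_eq 7 (by norm_num) 3 6 (by norm_num)]
    norm_num
  · obtain ⟨C, hc, h1, hE⟩ := exists_petersenCross_riesz 4 4 8 (by norm_num)
    refine ⟨C, hc, h1, ?_⟩
    rw [hE, dipValue_of_eq 8 (by norm_num) 4 8 (by norm_num)]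
    norm_num

end Summit.Ventures.PackingBounds.Conjectures

end
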